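import Mathlib
import Summits.NavierStokesRegularity.NavierStokesRegularity.Theorems.ThreadingFluxSilentShellsJiuXinSlabBounds
import HarnessLib

/-!
# Crux `PoloidalLiouville` (stmt-NavierStokesRegularity-1222, W1), crux idea «silent-shells»:
# towards the PRINTED Jiu–Xin Liouville theorem — `ε → 0⁺` in the slab and the absorption

Fifth file for `SilentShells.jiuXin2008_thm53`.  From the slab identity (`…JiuXinSlabIdentity`), with
`A_ε = ∫η_Z²|U_h|²/(ρ²+ε²)`, `B_ε = ∫η_Z²|U_h|²·2ε²/(ρ²+ε²)²`, the cross term `C_ε = ∫2η_Z d_Z U₂⟪U,G_ε⟫` and the pressure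
term `Π_ε = ∫η_Z²(P−p₀)k_ε`:  `A_ε = B_ε + C_ε + Π_ε`.  The cross term is ABSORBED,
`|C_ε| ≤ ½A_ε + 2(4S/3Z)²‖U‖²_{L²}` (pointwise `2|η d U₂⟪U,G_ε⟫| ≤ ½η²|U_h|²/(ρ²+ε²) + 2d²U₂²` from
`⟪U_h,x_h⟫² ≤ ρ²|U_h|²`), the pressure term satisfies `Π_ε ≤ (M_Pδ/2)·C_Z + (M_P/2δ + B)·J_ε` with `J_ε → 0`, and
`A_ε → ∫η_Z²|U_h|²/ρ²`, `B_ε → 0` (dominated convergence on the compact core).  Hence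

  `slab_horSq_le`:  `∫ η_Z² |U_h|²/ρ² ≤ C/Z²`  for every `Z > 0`, with `C = (64S²/9)‖U‖²_{L²}`.

All `--supports stmt-NavierStokesRegularity-1222 --as helper`; W1 movement 0; NS regularity is NOT proved by any of this.
Reference: [JiuXin2008, Thm 5.3, (3.24)–(3.30)].
-/

-- the summit and its single problem share the name (D-0017 nested layout)
set_option linter.dupNamespace false

noncomputable section

namespace Summit.NavierStokesRegularity.NavierStokesRegularity.Theorems.PoloidalLiouville.SilentShells

open Set Function Filter MeasureTheory Topology Metric
open scoped Topology RealInnerProductSpace ENNReal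
open Literature.Analysis.FluidPDE
open Summit.NavierStokesRegularity.NavierStokesRegularity.Theorems.PoloidalLiouville.HorizonTower (E3)

namespace JiuXin

/-! ## `∫ η_Z² k_ε min(ρ²,1) → 0` -/

/-- `k_ε · min(ρ², 1) ≤ 8/(ρ²+1)²` for `0 < |ε| ≤ 1`. -/
theorem kernel_mul_min_le {ε : ℝ} (hε : ε ≠ 0) (hε1 : |ε| ≤ 1) (x : E3) :
    2 * ε ^ 2 / (cylSq x + ε ^ 2) ^ 2 * min (cylSq x) 1 ≤ 8 / (cylSq x + 1) ^ 2 := by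
  have hq := cylSq_nonneg x
  have hqe := cylSq_add_sq_pos hε x
  have he2 : ε ^ 2 ≤ 1 := by rw [← sq_abs]; exact pow_le_one₀ (abs_nonneg ε) hε1
  have he0 : 0 < ε ^ 2 := by positivity
  rw [div_mul_eq_mul_div, div_le_div_iff₀ (pow_pos hqe 2) (by positivity)]
  by_cases h1 : cylSq x ≤ 1
  · rw [min_eq_left h1]
    -- `2ε²q (q+1)² ≤ 8 (q+ε²)²`: `(q+1)² ≤ 4` and `2ε² q ≤ (q+ε²)²·... ` via `4 q ε² ≤ (q + ε²)²`
    nlinarith [sq_nonneg (cylSq x - ε ^ 2), mul_nonneg hq he0.le, sq_nonneg (cylSq x + 1),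
      mul_le_mul_of_nonneg_left h1 hq]
  · rw [not_le] at h1
    rw [min_eq_right h1.le, mul_one]
    -- `2ε² (q+1)² ≤ 8 (q+ε²)²` since `q+1 ≤ 2q ≤ 2(q+ε²)`
    nlinarith [sq_nonneg (cylSq x + ε ^ 2), mul_pos he0 he0]

/-- `∫ η_Z² k_ε min(ρ²,1) → 0` as `ε → 0⁺` (dominated by `8η_Z²/(ρ²+1)²`, pointwise to `0` off the axis). -/
theorem tendsto_integral_vertCut_sq_kernel_min {Z : ℝ} (hZ : 0 < Z) :
    Tendsto (fun ε : ℝ => ∫ x, vertCut Z x ^ 2 * (2 * ε ^ 2 / (cylSq x + ε ^ 2) ^ 2 * min (cylSq x) 1))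
      (𝓝[>] 0) (𝓝 0) := by
  have hηc : Continuous (vertCut Z) := (contDiff_vertCut (n := 0) Z).continuous
  have hmaj := (integrable_vertCut_sq_div hZ one_pos).const_mul 8
  have h := tendsto_integral_filter_of_dominated_convergence (μ := (volume : Measure E3)) (l := 𝓝[>] (0 : ℝ))
    (F := fun ε x => vertCut Z x ^ 2 * (2 * ε ^ 2 / (cylSq x + ε ^ 2) ^ 2 * min (cylSq x) 1))
    (f := fun _ => (0 : ℝ)) (fun x => 8 * (vertCut Z x ^ 2 / (cylSq x + 1) ^ 2)) ?_ ?_ hmaj ?_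
  · simpa using h
  · have hI : Ioo (0 : ℝ) 1 ∈ 𝓝[>] (0 : ℝ) := Ioo_mem_nhdsGT one_pos
    filter_upwards [hI] with ε hε
    refine Continuous.aestronglyMeasurable ((hηc.pow 2).mul ((continuous_const.div
      ((continuous_cylSq.add continuous_const).pow 2) fun x => pow_ne_zero 2
        (cylSq_add_sq_pos hε.1.ne' x).ne').mul (continuous_cylSq.min continuous_const)))
  · have hI : Ioo (0 : ℝ) 1 ∈ 𝓝[>] (0 : ℝ) := Ioo_mem_nhdsGT one_pos
    filter_upwards [hI] with ε hε
    refine Eventually.of_forall fun x => ?_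
    have hk := kernel_mul_min_le hε.1.ne' (by rw [abs_of_pos hε.1]; exact hε.2.le) x
    have h0 : 0 ≤ 2 * ε ^ 2 / (cylSq x + ε ^ 2) ^ 2 * min (cylSq x) 1 :=
      mul_nonneg (by positivity) (le_min (cylSq_nonneg x) zero_le_one)
    rw [Real.norm_eq_abs, abs_mul, abs_of_nonneg (sq_nonneg _), abs_of_nonneg h0]
    calc vertCut Z x ^ 2 * (2 * ε ^ 2 / (cylSq x + ε ^ 2) ^ 2 * min (cylSq x) 1)
        ≤ vertCut Z x ^ 2 * (8 / (cylSq x + 1) ^ 2) := by gcongr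
      _ = 8 * (vertCut Z x ^ 2 / (cylSq x + 1) ^ 2) := by ring
  · refine Eventually.of_forall fun x => ?_
    by_cases hq : cylSq x = 0
    · simp only [hq, min_eq_left (zero_le_one (α := ℝ)), mul_zero]
      exact tendsto_const_nhds
    · have hqp : 0 < cylSq x := lt_of_le_of_ne (cylSq_nonneg x) (Ne.symm hq)
      have hcont : Continuous fun ε : ℝ =>
          vertCut Z x ^ 2 * (2 * ε ^ 2 / (cylSq x + ε ^ 2) ^ 2 * min (cylSq x) 1) :=
        continuous_const.mul (((continuous_const.mul (continuous_pow 2)).div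
          ((continuous_const.add (continuous_pow 2)).pow 2) fun ε =>
            pow_ne_zero 2 (add_pos_of_pos_of_nonneg hqp (sq_nonneg ε)).ne').mul continuous_const)
      have h := (hcont.tendsto 0).mono_left (nhdsWithin_le_nhds (s := Ioi (0 : ℝ)))
      simpa using h

section Euler

variable {U : E3 → E3} {P : E3 → ℝ}


/-- The elementary absorption inequality: `t² ≤ h` ⇒ `|2η(du)t| ≤ ½η²h + 2(du)²`. -/
theorem cross_abs_le (η d u t h : ℝ) (ht : t ^ 2 ≤ h) :
    |2 * η * (d * u) * t| ≤ 1 / 2 * (η ^ 2 * h) + 2 * (d * u) ^ 2 := by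
  rw [abs_le]
  constructor
  · nlinarith [sq_nonneg (η * t + 2 * (d * u)), mul_le_mul_of_nonneg_left ht (sq_nonneg η)]
  · nlinarith [sq_nonneg (η * t - 2 * (d * u)), mul_le_mul_of_nonneg_left ht (sq_nonneg η)]

/-- `⟪U, G_ε x⟫² ≤ |U_h|²/(ρ²+ε²)` (Cauchy–Schwarz in the horizontal plane). -/
theorem inner_testField_sq_le {ε : ℝ} (hε : ε ≠ 0) (U : E3 → E3) (x : E3) :
    ⟪U x, testField ε x⟫ ^ 2 ≤ (U x 0 * U x 0 + U x 1 * U x 1) / (cylSq x + ε ^ 2) := by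
  have hw := cylSq_add_sq_pos hε x
  rw [testField, inner_smul_right, inner_hor, le_div_iff₀ hw]
  have hcs : (U x 0 * x 0 + U x 1 * x 1) ^ 2 ≤ cylSq x * (U x 0 * U x 0 + U x 1 * U x 1) := by
    unfold cylSq; nlinarith [sq_nonneg (x 0 * U x 1 - x 1 * U x 0)]
  have hq : cylSq x ≤ cylSq x + ε ^ 2 := by nlinarith [sq_nonneg ε]
  have hs0 := horSq_nonneg U x
  calc ((cylSq x + ε ^ 2)⁻¹ * (U x 0 * x 0 + U x 1 * x 1)) ^ 2 * (cylSq x + ε ^ 2)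
      = (U x 0 * x 0 + U x 1 * x 1) ^ 2 / (cylSq x + ε ^ 2) := by field_simp
    _ ≤ cylSq x * (U x 0 * U x 0 + U x 1 * U x 1) / (cylSq x + ε ^ 2) := by gcongr
    _ ≤ (cylSq x + ε ^ 2) * (U x 0 * U x 0 + U x 1 * U x 1) / (cylSq x + ε ^ 2) := by gcongr
    _ = U x 0 * U x 0 + U x 1 * U x 1 := by field_simp

/-- **The slab estimate** (absorption + `ε → 0⁺`): for a `C¹` steady Euler pair, axisymmetric without swirl, with
`U ∈ L²`, `U → 0` and `P → p₀` at infinity, there is `C` (`= (64S²/9)‖U‖²_{L²}`) with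
`∫ η_Z² |U_h|²/ρ² ≤ C/Z²` for every `Z > 0`. [cite: JiuXin2008, (3.30)] -/
theorem slab_horSq_le (hU : ContDiff ℝ 1 U) (hP : ContDiff ℝ 1 P) (hdiv : VectorCalculus.IsDivFree U)
    (hE : ∀ x, convect U U x + gradient P x = 0) (hax : IsAxisymmetric U) (hsw : HasNoSwirl U)
    (hL2 : MemLp U 2 (volume : Measure E3)) (hU0 : Tendsto U (cocompact E3) (𝓝 0)) {p₀ : ℝ}
    (hp : Tendsto P (cocompact E3) (𝓝 p₀)) :
    ∃ C : ℝ, ∀ Z : ℝ, 0 < Z →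
      ∫ x, vertCut Z x ^ 2 * ((U x 0 * U x 0 + U x 1 * U x 1) / cylSq x) ≤ C / Z ^ 2 := by
  obtain ⟨S, hS0, hS⟩ := exists_deriv_smoothTransition_bound
  have hUc : Continuous U := hU.continuous
  have hUd : Differentiable ℝ U := hU.differentiable one_ne_zero
  have hPc : Continuous P := hP.continuous
  have hU2 := integrable_norm_sq_of_memLp hUc hL2
  set N : ℝ := ∫ x, ‖U x‖ ^ 2 with hN
  have hN0 : 0 ≤ N := integral_nonneg fun x => by positivity
  refine ⟨2 * (2 * (4 * S / 3) ^ 2 * N), fun Z hZ => ?_⟩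
  -- players (`hs` = |U_h|², made opaque so that rewriting is predictable)
  obtain ⟨hs, hhs⟩ : ∃ hs : E3 → ℝ, hs = fun x => U x 0 * U x 0 + U x 1 * U x 1 := ⟨_, rfl⟩
  have hhs' : ∀ x, U x 0 * U x 0 + U x 1 * U x 1 = hs x := fun x => by rw [hhs]
  simp only [hhs']
  have hs0 : ∀ x, 0 ≤ hs x := fun x => by rw [hhs]; exact horSq_nonneg U x
  have hηc : Continuous (vertCut Z) := (contDiff_vertCut (n := 0) Z).continuous
  have hη2 : ∀ x, vertCut Z x ^ 2 ≤ 1 := fun x => pow_le_one₀ (vertCut_nonneg Z x) (vertCut_le_one Z x)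
  have hhsc : Continuous hs := by rw [hhs]; exact continuous_horSq hUc
  have hsax : ∀ x, cylSq x = 0 → hs x = 0 := fun x hq => by
    rw [hhs]; exact horSq_eq_zero_of_cylSq_eq_zero hax hUd hq
  set L : ℝ := ∫ x, vertCut Z x ^ 2 * (hs x / cylSq x) with hL
  obtain ⟨A, hA⟩ : ∃ A : ℝ → ℝ, A = fun ε => ∫ x, vertCut Z x ^ 2 * (hs x / (cylSq x + ε ^ 2)) := ⟨_, rfl⟩
  obtain ⟨Bq, hBq⟩ : ∃ Bq : ℝ → ℝ,
      Bq = fun ε => ∫ x, vertCut Z x ^ 2 * (hs x * (2 * ε ^ 2 / (cylSq x + ε ^ 2) ^ 2)) := ⟨_, rfl⟩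
  obtain ⟨Cx, hCx⟩ : ∃ Cx : ℝ → ℝ,
      Cx = fun ε => ∫ x, 2 * vertCut Z x * (vertCutCoeff Z x * U x 2) * ⟪U x, testField ε x⟫ := ⟨_, rfl⟩
  obtain ⟨Pr, hPr⟩ : ∃ Pr : ℝ → ℝ,
      Pr = fun ε => ∫ x, vertCut Z x ^ 2 * ((P x - p₀) * (2 * ε ^ 2 / (cylSq x + ε ^ 2) ^ 2)) := ⟨_, rfl⟩
  obtain ⟨J, hJ⟩ : ∃ J : ℝ → ℝ,
      J = fun ε => ∫ x, vertCut Z x ^ 2 * (2 * ε ^ 2 / (cylSq x + ε ^ 2) ^ 2 * min (cylSq x) 1) := ⟨_, rfl⟩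
  obtain ⟨Kk, hKk⟩ : ∃ Kk : ℝ → ℝ,
      Kk = fun ε => ∫ x, vertCut Z x ^ 2 * (2 * ε ^ 2 / (cylSq x + ε ^ 2) ^ 2) := ⟨_, rfl⟩
  obtain ⟨M, B, hM0, hB0, hPB⟩ := pressure_sub_le_slab hU hP hax hE hU0 hp hZ
  set V : ℝ := (volume (cyl 4 (2 * Z))).toReal with hV
  have hV0 : 0 ≤ V := ENNReal.toReal_nonneg
  set c₁ : ℝ := 2 * (4 * S / (3 * Z)) ^ 2 * N with hc₁
  -- the integrable majorant `η² |U_h|²/ρ²` and the two velocity integrands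
  have hmaj : Integrable (fun x => vertCut Z x ^ 2 * (hs x / cylSq x)) (volume : Measure E3) := by
    rw [hhs]; exact integrable_vertCut_sq_horSq_div hU hax hL2 hZ
  have hcontA : ∀ {ε : ℝ}, ε ≠ 0 → Continuous fun x => vertCut Z x ^ 2 * (hs x / (cylSq x + ε ^ 2)) :=
    fun hε => (hηc.pow 2).mul (hhsc.div (continuous_cylSq.add continuous_const) fun x => (cylSq_add_sq_pos hε x).ne')
  have hkc : ∀ {ε : ℝ}, ε ≠ 0 → Continuous fun x : E3 => 2 * ε ^ 2 / (cylSq x + ε ^ 2) ^ 2 := fun hε =>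
    continuous_const.div ((continuous_cylSq.add continuous_const).pow 2)
      fun x => pow_ne_zero 2 (cylSq_add_sq_pos hε x).ne'
  have hcontB : ∀ {ε : ℝ}, ε ≠ 0 → Continuous fun x => vertCut Z x ^ 2 * (hs x * (2 * ε ^ 2 / (cylSq x + ε ^ 2) ^ 2)) :=
    fun hε => (hηc.pow 2).mul (hhsc.mul (hkc hε))
  -- pointwise: `η² hs/(q+ε²) ≤ η² hs/q` and `η² hs·2ε²/(q+ε²)² ≤ 2 η² hs/q`
  have hleA : ∀ {ε : ℝ}, ε ≠ 0 → ∀ x, vertCut Z x ^ 2 * (hs x / (cylSq x + ε ^ 2)) ≤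
      vertCut Z x ^ 2 * (hs x / cylSq x) := by
    intro ε hε x
    by_cases hq : cylSq x = 0
    · simp [hsax x hq]
    · exact mul_le_mul_of_nonneg_left (div_le_div_of_nonneg_left (hs0 x)
        (lt_of_le_of_ne (cylSq_nonneg x) (Ne.symm hq)) (by nlinarith [sq_nonneg ε])) (sq_nonneg _)
  have hleB : ∀ {ε : ℝ}, ε ≠ 0 → ∀ x, vertCut Z x ^ 2 * (hs x * (2 * ε ^ 2 / (cylSq x + ε ^ 2) ^ 2)) ≤
      2 * (vertCut Z x ^ 2 * (hs x / cylSq x)) := by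
    intro ε hε x
    have hw := cylSq_add_sq_pos hε x
    have h1 : hs x * (2 * ε ^ 2 / (cylSq x + ε ^ 2) ^ 2) ≤ 2 * (hs x / (cylSq x + ε ^ 2)) := by
      rw [mul_div_assoc', div_le_iff₀ (pow_pos hw 2)]
      have : 2 * (hs x / (cylSq x + ε ^ 2)) * (cylSq x + ε ^ 2) ^ 2 = 2 * hs x * (cylSq x + ε ^ 2) := by
        field_simp
      rw [this]; nlinarith [hs0 x, cylSq_nonneg x, sq_nonneg ε]
    have h2 := hleA hε x
    nlinarith [sq_nonneg (vertCut Z x), h1, h2]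
  have hintA : ∀ {ε : ℝ}, ε ≠ 0 → Integrable (fun x => vertCut Z x ^ 2 * (hs x / (cylSq x + ε ^ 2)))
      (volume : Measure E3) := fun hε =>
    Integrable.mono' hmaj (hcontA hε).aestronglyMeasurable (Eventually.of_forall fun x => by
      rw [Real.norm_eq_abs, abs_of_nonneg (mul_nonneg (sq_nonneg _) (div_nonneg (hs0 x)
        (cylSq_add_sq_pos hε x).le))]
      exact hleA hε x)
  have hintB : ∀ {ε : ℝ}, ε ≠ 0 → Integrable (fun x => vertCut Z x ^ 2 * (hs x * (2 * ε ^ 2 / (cylSq x + ε ^ 2) ^ 2)))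
      (volume : Measure E3) := fun hε =>
    Integrable.mono' (hmaj.const_mul 2) (hcontB hε).aestronglyMeasurable (Eventually.of_forall fun x => by
      rw [Real.norm_eq_abs, abs_of_nonneg (mul_nonneg (sq_nonneg _) (mul_nonneg (hs0 x) (by positivity)))]
      exact hleB hε x)
  -- (i) the identity `A = Bq + Cx + Pr`
  have hI : ∀ {ε : ℝ}, ε ≠ 0 → A ε = Bq ε + Cx ε + Pr ε := by
    intro ε hε
    have hsl := slab_identity hU hP hdiv hE hsw hL2 hp hZ hε
    have hpt : ∀ x, vertCut Z x ^ 2 * (hs x * ((ε ^ 2 - cylSq x) / (cylSq x + ε ^ 2) ^ 2)) =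
        vertCut Z x ^ 2 * (hs x * (2 * ε ^ 2 / (cylSq x + ε ^ 2) ^ 2)) -
          vertCut Z x ^ 2 * (hs x / (cylSq x + ε ^ 2)) := by
      intro x
      have hw := (cylSq_add_sq_pos hε x).ne'
      have key : (ε ^ 2 - cylSq x) / (cylSq x + ε ^ 2) ^ 2 =
          2 * ε ^ 2 / (cylSq x + ε ^ 2) ^ 2 - 1 / (cylSq x + ε ^ 2) := by
        field_simp; ring
      rw [key]; ring
    simp only [hhs'] at hsl
    simp_rw [hpt, integral_sub (hintB hε) (hintA hε)] at hsl
    simp only [hA, hBq, hCx, hPr]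
    linarith
  -- (ii) absorption of the cross term
  have hII : ∀ {ε : ℝ}, ε ≠ 0 → |Cx ε| ≤ 1 / 2 * A ε + c₁ := by
    intro ε hε
    have hd := abs_vertCutCoeff_le hS0 hS hZ
    have hpt : ∀ x, ‖2 * vertCut Z x * (vertCutCoeff Z x * U x 2) * ⟪U x, testField ε x⟫‖ ≤
        1 / 2 * (vertCut Z x ^ 2 * (hs x / (cylSq x + ε ^ 2))) + 2 * (4 * S / (3 * Z)) ^ 2 * ‖U x‖ ^ 2 := by
      intro x
      rw [Real.norm_eq_abs]
      have h1 := cross_abs_le (vertCut Z x) (vertCutCoeff Z x) (U x 2) ⟪U x, testField ε x⟫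
        (hs x / (cylSq x + ε ^ 2)) (by rw [hhs]; exact inner_testField_sq_le hε U x)
      have h2 : (vertCutCoeff Z x * U x 2) ^ 2 ≤ (4 * S / (3 * Z)) ^ 2 * ‖U x‖ ^ 2 := by
        rw [mul_pow, ← sq_abs (vertCutCoeff Z x), ← sq_abs (U x 2)]
        exact mul_le_mul (pow_le_pow_left₀ (abs_nonneg _) (hd x) 2)
          (pow_le_pow_left₀ (abs_nonneg _) (((pow_le_pow_iff_left₀ (abs_nonneg _) (norm_nonneg _) two_ne_zero).mp (sq_abs_apply_two_le_norm_sq (U x)))) 2) (sq_nonneg _) (sq_nonneg _)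
      have h3 : 2 * vertCut Z x * (vertCutCoeff Z x * U x 2) * ⟪U x, testField ε x⟫ =
          2 * vertCut Z x * (vertCutCoeff Z x * U x 2) * ⟪U x, testField ε x⟫ := rfl
      calc |2 * vertCut Z x * (vertCutCoeff Z x * U x 2) * ⟪U x, testField ε x⟫|
          ≤ 1 / 2 * (vertCut Z x ^ 2 * (hs x / (cylSq x + ε ^ 2))) + 2 * (vertCutCoeff Z x * U x 2) ^ 2 := h1
        _ ≤ 1 / 2 * (vertCut Z x ^ 2 * (hs x / (cylSq x + ε ^ 2))) + 2 * ((4 * S / (3 * Z)) ^ 2 * ‖U x‖ ^ 2) := by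
            gcongr
        _ = _ := by ring
    have hg : Integrable (fun x => 1 / 2 * (vertCut Z x ^ 2 * (hs x / (cylSq x + ε ^ 2))) +
        2 * (4 * S / (3 * Z)) ^ 2 * ‖U x‖ ^ 2) (volume : Measure E3) :=
      ((hintA hε).const_mul _).add (hU2.const_mul _)
    have h := norm_integral_le_of_norm_le hg (Eventually.of_forall hpt)
    rw [integral_add ((hintA hε).const_mul _) (hU2.const_mul _), integral_const_mul, integral_const_mul] at h
    rw [← Real.norm_eq_abs]
    simpa [hCx, hA, hc₁] using h
  -- (iii) the pressure term
  have hIII : ∀ {ε : ℝ}, ε ≠ 0 → ∀ {δ : ℝ}, 0 < δ → Pr ε ≤ M * (δ / 2) * Kk ε + (M / (2 * δ) + B) * J ε := by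
    intro ε hε δ hδ
    have hk0 : ∀ x, 0 ≤ 2 * ε ^ 2 / (cylSq x + ε ^ 2) ^ 2 := fun x => by positivity
    have hpt : ∀ x, vertCut Z x ^ 2 * ((P x - p₀) * (2 * ε ^ 2 / (cylSq x + ε ^ 2) ^ 2)) ≤
        M * (δ / 2) * (vertCut Z x ^ 2 * (2 * ε ^ 2 / (cylSq x + ε ^ 2) ^ 2)) +
          (M / (2 * δ) + B) * (vertCut Z x ^ 2 * (2 * ε ^ 2 / (cylSq x + ε ^ 2) ^ 2 * min (cylSq x) 1)) := by
      intro x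
      by_cases hz : |x 2| ≤ 2 * Z
      · have h1 := hPB δ hδ x hz
        have h2 : 0 ≤ vertCut Z x ^ 2 * (2 * ε ^ 2 / (cylSq x + ε ^ 2) ^ 2) := mul_nonneg (sq_nonneg _) (hk0 x)
        calc vertCut Z x ^ 2 * ((P x - p₀) * (2 * ε ^ 2 / (cylSq x + ε ^ 2) ^ 2))
            = (P x - p₀) * (vertCut Z x ^ 2 * (2 * ε ^ 2 / (cylSq x + ε ^ 2) ^ 2)) := by ring
          _ ≤ (M * (δ / 2) + (M / (2 * δ) + B) * min (cylSq x) 1) *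
              (vertCut Z x ^ 2 * (2 * ε ^ 2 / (cylSq x + ε ^ 2) ^ 2)) := mul_le_mul_of_nonneg_right h1 h2
          _ = _ := by ring
      · rw [not_le] at hz
        rw [vertCut_eq_zero hZ hz.le]
        simp
    have hiP : Integrable (fun x => vertCut Z x ^ 2 * ((P x - p₀) * (2 * ε ^ 2 / (cylSq x + ε ^ 2) ^ 2)))
        (volume : Measure E3) := by
      obtain ⟨B', hB'0, hB'⟩ := exists_bound_of_tendsto_cocompact hPc hp
      refine integrable_of_le_vertCut_weight (K := B' * (2 * ε ^ 2)) hZ (by positivity : (0 : ℝ) < ε ^ 2)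
        ((hηc.pow 2).mul ((hPc.sub continuous_const).mul (hkc hε))).aestronglyMeasurable fun x => ?_
      rw [Real.norm_eq_abs, abs_mul, abs_mul, abs_of_nonneg (sq_nonneg _), abs_of_nonneg (hk0 x)]
      calc vertCut Z x ^ 2 * (|P x - p₀| * (2 * ε ^ 2 / (cylSq x + ε ^ 2) ^ 2))
          ≤ vertCut Z x ^ 2 * (B' * (2 * ε ^ 2 / (cylSq x + ε ^ 2) ^ 2)) := by gcongr; exact hB' x
        _ = B' * (2 * ε ^ 2) * (vertCut Z x ^ 2 / (cylSq x + ε ^ 2) ^ 2) := by ring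
    have hiK : Integrable (fun x => vertCut Z x ^ 2 * (2 * ε ^ 2 / (cylSq x + ε ^ 2) ^ 2)) (volume : Measure E3) := by
      refine integrable_of_le_vertCut_weight (K := 2 * ε ^ 2) hZ (by positivity : (0 : ℝ) < ε ^ 2)
        ((hηc.pow 2).mul (hkc hε)).aestronglyMeasurable fun x => ?_
      rw [Real.norm_eq_abs, abs_of_nonneg (mul_nonneg (sq_nonneg _) (hk0 x))]
      exact le_of_eq (by ring)
    have hiJ : Integrable (fun x => vertCut Z x ^ 2 * (2 * ε ^ 2 / (cylSq x + ε ^ 2) ^ 2 * min (cylSq x) 1))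
        (volume : Measure E3) := by
      refine Integrable.mono' hiK (((hηc.pow 2).mul ((hkc hε).mul (continuous_cylSq.min continuous_const)))
        |>.aestronglyMeasurable) (Eventually.of_forall fun x => ?_)
      have hm0 : 0 ≤ min (cylSq x) 1 := le_min (cylSq_nonneg x) zero_le_one
      have hm1 : min (cylSq x) 1 ≤ 1 := min_le_right _ _
      rw [Real.norm_eq_abs, abs_of_nonneg (mul_nonneg (sq_nonneg _) (mul_nonneg (hk0 x) hm0))]
      calc vertCut Z x ^ 2 * (2 * ε ^ 2 / (cylSq x + ε ^ 2) ^ 2 * min (cylSq x) 1)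
          ≤ vertCut Z x ^ 2 * (2 * ε ^ 2 / (cylSq x + ε ^ 2) ^ 2 * 1) := by gcongr
        _ = _ := by ring
    have hsum : Integrable (fun x => M * (δ / 2) * (vertCut Z x ^ 2 * (2 * ε ^ 2 / (cylSq x + ε ^ 2) ^ 2)) +
        (M / (2 * δ) + B) * (vertCut Z x ^ 2 * (2 * ε ^ 2 / (cylSq x + ε ^ 2) ^ 2 * min (cylSq x) 1)))
        (volume : Measure E3) := (hiK.const_mul _).add (hiJ.const_mul _)
    have h := integral_mono hiP hsum hpt
    rw [integral_add (hiK.const_mul _) (hiJ.const_mul _), integral_const_mul, integral_const_mul] at h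
    simp only [hPr, hKk, hJ]
    exact h
  -- (iv) the mass bound, (v) the three limits
  have hIV : ∀ {ε : ℝ}, ε ≠ 0 → Kk ε ≤ 2 * S / 3 * V := fun hε => by
    simp only [hKk]; exact integral_vertCut_sq_kernel_le hS0 hS hZ hε
  have hJ0 : Tendsto J (𝓝[>] 0) (𝓝 0) := by rw [hJ]; exact tendsto_integral_vertCut_sq_kernel_min hZ
  have hA0 : Tendsto A (𝓝[>] 0) (𝓝 L) := by
    rw [hA, hL]
    refine tendsto_integral_filter_of_dominated_convergence (fun x => vertCut Z x ^ 2 * (hs x / cylSq x)) ?_ ?_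
      hmaj ?_
    · filter_upwards [self_mem_nhdsWithin] with ε (hε : 0 < ε)
      exact (hcontA hε.ne').aestronglyMeasurable
    · filter_upwards [self_mem_nhdsWithin] with ε (hε : 0 < ε)
      refine Eventually.of_forall fun x => ?_
      rw [Real.norm_eq_abs, abs_of_nonneg (mul_nonneg (sq_nonneg _) (div_nonneg (hs0 x)
        (cylSq_add_sq_pos hε.ne' x).le))]
      exact hleA hε.ne' x
    · refine Eventually.of_forall fun x => ?_
      by_cases hq : cylSq x = 0
      · simp only [hsax x hq, zero_div, mul_zero]
        exact tendsto_const_nhds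
      · have hqp : 0 < cylSq x := lt_of_le_of_ne (cylSq_nonneg x) (Ne.symm hq)
        have hcont : Continuous fun ε : ℝ => vertCut Z x ^ 2 * (hs x / (cylSq x + ε ^ 2)) :=
          continuous_const.mul (continuous_const.div (continuous_const.add (continuous_pow 2))
            fun ε => (add_pos_of_pos_of_nonneg hqp (sq_nonneg ε)).ne')
        have h := (hcont.tendsto 0).mono_left (nhdsWithin_le_nhds (s := Ioi (0 : ℝ)))
        simpa using h
  have hB0' : Tendsto Bq (𝓝[>] 0) (𝓝 0) := by
    rw [hBq]
    have h := tendsto_integral_filter_of_dominated_convergence (μ := (volume : Measure E3)) (l := 𝓝[>] (0 : ℝ))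
      (F := fun ε x => vertCut Z x ^ 2 * (hs x * (2 * ε ^ 2 / (cylSq x + ε ^ 2) ^ 2))) (f := fun _ => (0 : ℝ))
      (fun x => 2 * (vertCut Z x ^ 2 * (hs x / cylSq x))) ?_ ?_ (hmaj.const_mul 2) ?_
    · simpa using h
    · filter_upwards [self_mem_nhdsWithin] with ε (hε : 0 < ε)
      exact (hcontB hε.ne').aestronglyMeasurable
    · filter_upwards [self_mem_nhdsWithin] with ε (hε : 0 < ε)
      refine Eventually.of_forall fun x => ?_
      rw [Real.norm_eq_abs, abs_of_nonneg (mul_nonneg (sq_nonneg _) (mul_nonneg (hs0 x) (by positivity)))]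
      exact hleB hε.ne' x
    · refine Eventually.of_forall fun x => ?_
      by_cases hq : cylSq x = 0
      · simp only [hsax x hq, zero_mul, mul_zero]
        exact tendsto_const_nhds
      · have hqp : 0 < cylSq x := lt_of_le_of_ne (cylSq_nonneg x) (Ne.symm hq)
        have hcont : Continuous fun ε : ℝ => vertCut Z x ^ 2 * (hs x * (2 * ε ^ 2 / (cylSq x + ε ^ 2) ^ 2)) :=
          continuous_const.mul (continuous_const.mul ((continuous_const.mul (continuous_pow 2)).div
            ((continuous_const.add (continuous_pow 2)).pow 2)
              fun ε => pow_ne_zero 2 (add_pos_of_pos_of_nonneg hqp (sq_nonneg ε)).ne'))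
        have h := (hcont.tendsto 0).mono_left (nhdsWithin_le_nhds (s := Ioi (0 : ℝ)))
        simpa using h
  -- (vi) assemble: `½ A ≤ Bq + c₁ + M(δ/2)·(2S/3)V + (M/2δ + B)·J`, then `ε → 0⁺`, then `δ → 0⁺`
  have hhalf : ∀ δ : ℝ, 0 < δ → 1 / 2 * L ≤ c₁ + M * (δ / 2) * (2 * S / 3 * V) := by
    intro δ hδ
    have hev : ∀ᶠ ε in 𝓝[>] (0 : ℝ), 1 / 2 * A ε ≤ Bq ε + (c₁ + M * (δ / 2) * (2 * S / 3 * V)) +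
        (M / (2 * δ) + B) * J ε := by
      filter_upwards [self_mem_nhdsWithin] with ε (hε : 0 < ε)
      have h1 := hI hε.ne'
      have h2 := hII hε.ne'
      have h3 := hIII hε.ne' hδ
      have h4 := hIV hε.ne'
      have h5 : Cx ε ≤ 1 / 2 * A ε + c₁ := (le_abs_self _).trans h2
      have h6 : M * (δ / 2) * Kk ε ≤ M * (δ / 2) * (2 * S / 3 * V) := mul_le_mul_of_nonneg_left h4 (by positivity)
      linarith
    have hlim : Tendsto (fun ε => Bq ε + (c₁ + M * (δ / 2) * (2 * S / 3 * V)) + (M / (2 * δ) + B) * J ε)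
        (𝓝[>] 0) (𝓝 (0 + (c₁ + M * (δ / 2) * (2 * S / 3 * V)) + (M / (2 * δ) + B) * 0)) :=
      (hB0'.add tendsto_const_nhds).add (tendsto_const_nhds.mul hJ0)
    have := le_of_tendsto_of_tendsto (hA0.const_mul (1 / 2)) hlim hev
    linarith
  have hL1 : 1 / 2 * L ≤ c₁ := by
    refine le_of_forall_pos_le_add fun η hη => ?_
    have hK : 0 < M * (2 * S / 3 * V) + 1 := by positivity
    have h := hhalf (η / (M * (2 * S / 3 * V) + 1)) (by positivity)
    calc 1 / 2 * L ≤ c₁ + M * (η / (M * (2 * S / 3 * V) + 1) / 2) * (2 * S / 3 * V) := h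
      _ = c₁ + η / 2 * (M * (2 * S / 3 * V) / (M * (2 * S / 3 * V) + 1)) := by ring
      _ ≤ c₁ + η / 2 * 1 := by
          gcongr
          rw [div_le_one hK]; linarith
      _ ≤ c₁ + η := by linarith
  have hfin : L ≤ 2 * c₁ := by linarith
  calc L ≤ 2 * c₁ := hfin
    _ = 2 * (2 * (4 * S / 3) ^ 2 * N) / Z ^ 2 := by rw [hc₁]; field_simp

end Euler

end JiuXin

end Summit.NavierStokesRegularity.NavierStokesRegularity.Theorems.PoloidalLiouville.SilentShells

end
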